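import Summits.AtomisticToContinuum.HydrodynamicLimit.Theses.VitaliAmplitudeTransfer
import HarnessLib.Audit

/-!
# Birth skeleton (BC3) for the crux `UniformAmplitudeAnalyticity` (stmt-AtomisticToContinuum-11870)

Route `VitaliAmplitudeTransfer` (sub-problem `HydrodynamicLimit`), crux #2, decl
`Summit.AtomisticToContinuum.HydrodynamicLimit.Theses.VitaliAmplitudeTransfer.UniformAmplitudeAnalyticity`:
along a path of local-Gibbs profiles `(a, u, θ)_δ` real-analytic in `(δ, x)` on `[0,1] × 𝕋³`, the
time-`t` means `m_N(δ) = E_{ψ_δ^N}[∫ w dμ^emp(Φ^N_t z)]` of a one-body empirical observable are, for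
every `N`, restrictions of holomorphic functions bounded by ONE constant `M` on ONE complex
`r`-neighbourhood of `[0,1]` ("no dynamical Lee–Yang zeros before the shock").

## The line: the Lee–Yang / Vitali anatomy of the claim (Ruelle 1969, proof of Thm 5.1.3)

Write the mean as a quotient `m_N(δ) = N_N(δ) / Z_N(δ)` of two real-analytic functions of the amplitude:
* `Z_N(δ) = canonicalPartition G ε_N (N+1) (localGibbsProfile (a δ) (u δ) (θ δ))`, the normalising
  constant of the local Gibbs law (the local Maxwellians integrate to `1` in the velocities — also
  after complexification of `(u, θ)` — so `Z_N` IS the configurational canonical partition function of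
  `N+1` hard spheres with the inhomogeneous ACTIVITY PROFILE `a_δ`);
* `N_N(δ) = ∫ (W ∘ Φ_t) · 1_{D_ε} · (localGibbsProfile_δ)^{⊗(N+1)} dLiouville`, the unnormalised
  numerator (`localGibbsLaw = liouville.withDensity (Z_N⁻¹ · 1_{D_ε} · profile^{⊗})`).
Then the crux splits into three INDEPENDENT statements, exactly the three inputs of the classical
zero-free-region ⇒ Vitali mechanism, and the composition below is kernel-checked:
* `stub_canonicalZeroFreeStrip` (STATIC canonical Lee–Yang, size M–L): for `σ < σ₀(B)` the functions
  `Z_N` extend holomorphically AND ZERO-FREE to an `N`-uniform complex strip around `[0,1]`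
  (inhomogeneous complex-activity canonical cluster expansion at packing `σ³`: PulvirentiTsagkarogiannis2012,
  Ruelle1969 Thm 4.2.3, LebowitzPenrose1964; the complexification of the analytic path is uniform by
  compactness of `[0,1] × 𝕋³`).
* `stub_numeratorExtension` (FINITE-`N` holomorphy, size L, provable now): the products `m_N · Z_N`
  (= `N_N` on `[0,1]`, by unfolding `localGibbsLaw`/`particleLaw`/`canonicalDensity`) extend
  holomorphically to an `N`-UNIFORM strip — a dominated holomorphic parameter integral: the strip is the
  complexification width of the path (independent of `N`), the domination is Gaussian in the velocities
  (`Re θ_δ⁻¹ > 0` on a thin strip) times `|W ∘ Φ_t| ≤ C_w (1 + (N+1)⁻¹ Σ|vᵢ|²)` Liouville-a.e. (kinetic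
  energy is conserved on the good set: free flight + elastic `collidePair`).
* `stub_uniformBoundOnStrip` (DYNAMIC a-priori bound — the HARDEST stub, the open core): in the crux's
  own frame, ANY family `g_N` of holomorphic extensions of the means to an `N`-uniform strip is bounded
  by one constant on a thinner `N`-uniform strip. This is the cancellation statement (complex tilts
  transported by `≍ N^{1/3}` collision times per particle) that the route's "why it might fail" names;
  by the identity theorem it does not matter which extensions are fed in.
Composition `UniformAmplitudeAnalyticity_of`: `σ₀ := min σ₀^Z σ₀^B`; `g_N := Nc_N / Zc_N` is
holomorphic on the strip `min r₀ r₁` (`DifferentiableOn.div` + zero-freeness) and equals `m_N` on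
`[0,1]` (`m_N Z_N = N_N`, `Z_N ≠ 0`); the a-priori bound gives `r' ≤ min r₀ r₁` and `M`; restrict
(`Metric.thickening_mono`).

Why this cut is not a costume: `stub_canonicalZeroFreeStrip` has no dynamics and no observable;
`stub_numeratorExtension` has no smallness of `σ`, no Euler family, no bound; `stub_uniformBoundOnStrip`
produces no extension (it cannot even be applied without the other two). None is the crux or the summit
reworded (BC3 probes `stub → crux`, `stub → _root_.HydrodynamicLimit` by
`first | exact? | simpa | aesop` fail, see the planner folder `bc/*_probe.lean`).

Disproof used: none exists (`ledger crux ls stmt-AtomisticToContinuum-11870`: no workfiles, 2026-08-17);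
negatives index (20 refuted statements of the summit): none concerns complex-activity partition
functions, holomorphic extension in a profile parameter, or amplitude analyticity.

D-0027 §3.3 shape: registered stubs are `Holds.stub_*` (bodies `sorry`), their statements by name are
the `def stub_* : Prop := type_of% Holds.stub_*`, and `UniformAmplitudeAnalyticity_of` takes exactly
these as hypotheses and concludes the crux BY NAME.
-/

open MeasureTheory Set Metric
open Literature.MathematicalPhysics.KineticTheory Literature.Analysis.FluidPDE
open Literature.Analysis.FunctionSpaces

namespace Summit.AtomisticToContinuum.HydrodynamicLimit.Cruxes.UniformAmplitudeAnalyticity.Birth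

noncomputable section

/-! ## Registered stubs (`Holds.stub_*`, bodies `sorry`) -/

namespace Holds

/-- STUB S_Z — STATIC CANONICAL LEE–YANG STRIP (size M–L). For profile bounds `B ≥ 1` there is
`σ₀(B)` such that for `0 < σ < σ₀` and every path of profiles `(a, u, θ)_δ` jointly real-analytic in
`(δ, x)` on `[0,1] × 𝕋³` within the bounds, there is ONE `r > 0` such that for EVERY `N` the canonical
partition function of the local Gibbs profile along the path,
`δ ↦ Z_N(δ) = canonicalPartition G (hsDiameter σ N) (N+1) (localGibbsProfile (a δ) (u δ) (θ δ))`,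
is the restriction to `[0,1]` of a function holomorphic and WITHOUT ZEROS on the complex
`r`-neighbourhood of `[0,1]`. Content: (i) the velocity Maxwellians integrate to `1` (also for the
complexified `u, θ`, by analytic continuation), so `Z_N(δ) = ∫_{D_ε} ∏ᵢ a_δ(xᵢ) dx` is the
configurational canonical partition function with complex activity profile `a_δ`, entire in the
complexified activities; (ii) at packing `(N+1) ε_N³ = σ³ < σ₀³` the canonical cluster expansion in an
inhomogeneous complex activity close to a positive one converges uniformly in `N`
(`log (Z_N[a_δ]/Z_N[a_{Re δ}]) = O(N)` finite), hence no zeros. Why it might fail: only through the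
`N`-uniformity of the strip at the largest admissible packing — `σ₀(B)` is there to keep `σ³` inside the
convergence radius. Leans on: PulvirentiTsagkarogiannis2012 (canonical cluster expansion),
Ruelle1969 Thm 4.2.3, LebowitzPenrose1964; Mathlib `HasFPowerSeriesOnBall.changeOrigin` for the uniform
complexification of the analytic path. -/
theorem stub_canonicalZeroFreeStrip :
    ∀ B : ℝ, 1 ≤ B → ∃ σ₀ : ℝ, 0 < σ₀ ∧ ∀ σ : ℝ, 0 < σ → σ < σ₀ →
      ∀ (a θp : ℝ → T3 → ℝ) (up : ℝ → T3 → V3),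
        AnalyticOnNhd ℝ (Torus.stLift a) (Set.Icc 0 1 ×ˢ Set.univ) →
        AnalyticOnNhd ℝ (Torus.stLift θp) (Set.Icc 0 1 ×ˢ Set.univ) →
        AnalyticOnNhd ℝ (Torus.stLift up) (Set.Icc 0 1 ×ˢ Set.univ) →
        (∀ δ ∈ Set.Icc (0:ℝ) 1, ∀ x,
          B⁻¹ ≤ a δ x ∧ a δ x ≤ B ∧ B⁻¹ ≤ θp δ x ∧ θp δ x ≤ B ∧ ‖up δ x‖ ≤ B) →
        ∃ r : ℝ, 0 < r ∧ ∀ N : ℕ, ∃ Z : ℂ → ℂ,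
          DifferentiableOn ℂ Z (Metric.thickening r (Complex.ofReal '' Set.Icc (0:ℝ) 1)) ∧
          (∀ ζ ∈ Metric.thickening r (Complex.ofReal '' Set.Icc (0:ℝ) 1), Z ζ ≠ 0) ∧
          ∀ δ ∈ Set.Icc (0:ℝ) 1, Z (δ : ℂ) =
            ((canonicalPartition (Torus.geometry (Fin 3)) (hsDiameter σ N) (N + 1)
              (localGibbsProfile (a δ) (up δ) (θp δ)) : ℝ) : ℂ) := by
  sorry

/-- STUB S_E — FINITE-`N` HOLOMORPHY OF THE UNNORMALISED MEANS ON AN `N`-UNIFORM STRIP (size L,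
provable now). For `B ≥ 1`, ANY `σ > 0`, every analytic path within the bounds, every family of flows,
every time `t` and every continuous observable of quadratic velocity growth there is ONE `r > 0` such
that for EVERY `N` the product `m_N(δ) · Z_N(δ)` of the time-`t` mean
`m_N(δ) = ∫ (∫ w dμ^emp(Φ^N_t z)) dψ_δ^N(z)` with the canonical partition function `Z_N(δ)` is the
restriction to `[0,1]` of a function `Nc` holomorphic on the complex `r`-neighbourhood of `[0,1]`.
Content: `Nc(δ) := ∫ (W∘Φ_t) · 1_{D_ε} · ∏ᵢ (a_δ(xᵢ) M_{1,u_δ(xᵢ),θ_δ(xᵢ)}(vᵢ)) dLiouville` with the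
complexified profiles — (i) the analytic path complexifies to a strip of `N`-independent width with
`Re θ_δ⁻¹ ≥ (2B)⁻¹`, `|a_δ| ≤ 2B` (compactness of `[0,1] × 𝕋³`); (ii) `|W(Φ_t z)| ≤ C_w (1 + (N+1)⁻¹ Σ|vᵢ|²)`
for Liouville-a.e. `z` (kinetic energy is conserved on the good set, off it the law does not charge);
(iii) dominated holomorphic parameter integral (`hasDerivAt_integral_of_dominated_loc_of_deriv_le`);
(iv) on `[0,1]`: `localGibbsLaw = liouville.withDensity (ofReal ∘ canonicalDensity)`,
`canonicalDensity = Z_N⁻¹ · 1_{D_ε} · profile^{⊗(N+1)}`, so `m_N · Z_N = N_N` (`integral_withDensity_eq_integral_smul`;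
if `Z_N = 0` both sides vanish). No smallness of `σ`, no Euler family, no bound is claimed. Why it might
fail: it does not (finite-`N` analysis); the work is Lean bookkeeping of `withDensity`/`ofReal` and the
energy-conservation lemma for `IsHardSphereTrajectory`. Leans on: Mathlib parametric integrals,
`MeasureTheory.integral_withDensity_eq_integral_smul`, library `particleLaw_eq`, `HardSphereFlow.measurePreserving`. -/
theorem stub_numeratorExtension :
    ∀ B : ℝ, 1 ≤ B → ∀ σ : ℝ, 0 < σ →
      ∀ (a θp : ℝ → T3 → ℝ) (up : ℝ → T3 → V3),
        AnalyticOnNhd ℝ (Torus.stLift a) (Set.Icc 0 1 ×ˢ Set.univ) →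
        AnalyticOnNhd ℝ (Torus.stLift θp) (Set.Icc 0 1 ×ˢ Set.univ) →
        AnalyticOnNhd ℝ (Torus.stLift up) (Set.Icc 0 1 ×ˢ Set.univ) →
        (∀ δ ∈ Set.Icc (0:ℝ) 1, ∀ x,
          B⁻¹ ≤ a δ x ∧ a δ x ≤ B ∧ B⁻¹ ≤ θp δ x ∧ θp δ x ≤ B ∧ ‖up δ x‖ ≤ B) →
        ∀ Φ : (N : ℕ) → HardSphereFlow (Torus.geometry (Fin 3)) (hsDiameter σ N) (N + 1),
        ∀ (t : ℝ) (w : T3 × V3 → ℝ), Continuous w →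
          (∃ Cw : ℝ, ∀ y, |w y| ≤ Cw * (1 + ‖y.2‖ ^ 2)) →
        ∃ r : ℝ, 0 < r ∧ ∀ N : ℕ, ∃ Nc : ℂ → ℂ,
          DifferentiableOn ℂ Nc (Metric.thickening r (Complex.ofReal '' Set.Icc (0:ℝ) 1)) ∧
          ∀ δ ∈ Set.Icc (0:ℝ) 1,
            ((∫ z, (∫ y, w y ∂(empiricalMeasure ((Φ N).flow t z)))
                ∂(localGibbsLaw σ (a δ) (up δ) (θp δ) N (Φ N)) : ℝ) : ℂ) *
              ((canonicalPartition (Torus.geometry (Fin 3)) (hsDiameter σ N) (N + 1)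
                (localGibbsProfile (a δ) (up δ) (θp δ)) : ℝ) : ℂ) = Nc (δ : ℂ) := by
  sorry

/-- STUB S_B — THE DYNAMIC A-PRIORI BOUND ON AN `N`-UNIFORM STRIP (the HARDEST stub: the open core of
the crux, "no dynamical Lee–Yang condensation before the shock"). In the crux's own frame (`σ < σ₀(B)`,
analytic path within bounds, LLN-matched classical Euler family on `[0,T')`, laws probability measures,
`t < T'`, continuous `w` of quadratic velocity growth): for every `r > 0` and EVERY family `g_N` of
functions holomorphic on the complex `r`-neighbourhood of `[0,1]` that restrict to the means `m_N` on
`[0,1]`, there are `0 < r' ≤ r` and ONE constant `M` with `‖g_N‖ ≤ M` on the `r'`-neighbourhood for all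
`N`. (By the identity theorem the `g_N` are THE meromorphic continuations `N_N/Z_N`; the stub is the
statement that the complex-tilted, dynamically transported expectations
`E_G[e^{Λ_δ ∘ Φ_{-t}} W] / E_G[e^{Λ_δ}]` stay `O(1)` although both terms are `e^{O(N)}` and the
modulus of the denominator is exponentially smaller than `E_G[e^{Re Λ_δ}]` — a cancellation statement,
not an estimate of moduli.) At `t = 0` or for conserved `w` it is statics (bounded complex one-point
correlation functions, Ruelle1969 Thm 4.2.3); at `t > 0` it is the card's dynamical Lee–Yang claim and
carries the whole "why it might fail" of the crux: a real pinch of zeros of `δ ↦ E_G[e^{Λ(δ)} W∘Φ_t]`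
over `≍ N^{1/3}` collision times (hidden slow mode) before `T'`. First rungs for a prover: the kinetic
window `t ≤ c (N+1)^{-1/3}` (finitely many collisions per particle: dynamical cluster expansion at fixed
`σ`), and the OVY-noisy analogue. Leans on: Ruelle1969 §5.1, Spohn1991 §7.1 (7.16)–(7.18),
DoyonEtAl2023 (ballistic MFT cumulants), PulvirentiTsagkarogiannis2012. -/
theorem stub_uniformBoundOnStrip :
    ∀ B : ℝ, 1 ≤ B → ∃ σ₀ : ℝ, 0 < σ₀ ∧ ∀ σ : ℝ, 0 < σ → σ < σ₀ →
      ∀ (a θp : ℝ → T3 → ℝ) (up : ℝ → T3 → V3),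
        AnalyticOnNhd ℝ (Torus.stLift a) (Set.Icc 0 1 ×ˢ Set.univ) →
        AnalyticOnNhd ℝ (Torus.stLift θp) (Set.Icc 0 1 ×ˢ Set.univ) →
        AnalyticOnNhd ℝ (Torus.stLift up) (Set.Icc 0 1 ×ˢ Set.univ) →
        (∀ δ ∈ Set.Icc (0:ℝ) 1, ∀ x,
          B⁻¹ ≤ a δ x ∧ a δ x ≤ B ∧ B⁻¹ ≤ θp δ x ∧ θp δ x ≤ B ∧ ‖up δ x‖ ≤ B) →
        ∀ (T' : ℝ) (ρE θE : ℝ → ℝ → T3 → ℝ) (uE : ℝ → ℝ → T3 → V3),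
        (∀ δ ∈ Set.Icc (0:ℝ) 1, IsHardSphereEulerSolution σ T' (ρE δ) (uE δ) (θE δ)) →
        ∀ Φ : (N : ℕ) → HardSphereFlow (Torus.geometry (Fin 3)) (hsDiameter σ N) (N + 1),
        (∀ δ ∈ Set.Icc (0:ℝ) 1,
          (∀ N, IsProbabilityMeasure (localGibbsLaw σ (a δ) (up δ) (θp δ) N (Φ N))) ∧
          TendstoHydroFieldsAt (fun N => localGibbsLaw σ (a δ) (up δ) (θp δ) N (Φ N)) Φ
            (ρE δ) (uE δ) (θE δ) 0) →
        ∀ t ∈ Set.Ico 0 T', ∀ w : T3 × V3 → ℝ, Continuous w →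
          (∃ Cw : ℝ, ∀ y, |w y| ≤ Cw * (1 + ‖y.2‖ ^ 2)) →
        ∀ r : ℝ, 0 < r → ∀ g : ℕ → ℂ → ℂ,
          (∀ N : ℕ,
            DifferentiableOn ℂ (g N) (Metric.thickening r (Complex.ofReal '' Set.Icc (0:ℝ) 1)) ∧
            ∀ δ ∈ Set.Icc (0:ℝ) 1, g N (δ : ℂ) =
              ((∫ z, (∫ y, w y ∂(empiricalMeasure ((Φ N).flow t z)))
                ∂(localGibbsLaw σ (a δ) (up δ) (θp δ) N (Φ N)) : ℝ) : ℂ)) →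
          ∃ r' : ℝ, 0 < r' ∧ r' ≤ r ∧ ∃ M : ℝ, ∀ N : ℕ,
            ∀ ζ ∈ Metric.thickening r' (Complex.ofReal '' Set.Icc (0:ℝ) 1), ‖g N ζ‖ ≤ M := by
  sorry

end Holds

/-! ## Stub statements by name (D-0027 §3.3: the hypotheses of `_of` are these `Prop`s) -/

/-- Statement of registered stub S_Z (`Holds.stub_canonicalZeroFreeStrip`), by name. -/
def stub_canonicalZeroFreeStrip : Prop := type_of% Holds.stub_canonicalZeroFreeStrip
/-- Statement of registered stub S_E (`Holds.stub_numeratorExtension`), by name. -/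
def stub_numeratorExtension : Prop := type_of% Holds.stub_numeratorExtension
/-- Statement of registered stub S_B (`Holds.stub_uniformBoundOnStrip`), by name. -/
def stub_uniformBoundOnStrip : Prop := type_of% Holds.stub_uniformBoundOnStrip

/-! ## Composition (sorry-free): the registered stubs ⟹ the crux BY NAME -/

/-- **The skeleton theorem.** Zero-free strip (S_Z) + holomorphic numerator (S_E) give, for every `N`,
the meromorphic-hence-holomorphic continuation `g_N := Nc_N / Zc_N` of the mean `m_N` to the common
`N`-uniform strip `min r₀ r₁`; the a-priori bound (S_B) applied to this family gives `r' ≤ min r₀ r₁`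
and the single constant `M`; restricting `g_N` to the `r'`-strip proves the crux. -/
theorem UniformAmplitudeAnalyticity_of
    (hZ : stub_canonicalZeroFreeStrip) (hE : stub_numeratorExtension) (hB : stub_uniformBoundOnStrip) :
    Summit.AtomisticToContinuum.HydrodynamicLimit.Theses.VitaliAmplitudeTransfer.UniformAmplitudeAnalyticity := by
  have HZ := (hZ : type_of% Holds.stub_canonicalZeroFreeStrip)
  have HE := (hE : type_of% Holds.stub_numeratorExtension)
  have HB := (hB : type_of% Holds.stub_uniformBoundOnStrip)
  intro B hB1
  obtain ⟨σZ, hσZ, HZ⟩ := HZ B hB1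
  obtain ⟨σB, hσB, HB⟩ := HB B hB1
  refine ⟨min σZ σB, lt_min hσZ hσB, ?_⟩
  intro σ hσ hσlt a θp up ha hθ hu hbd T' ρE θE uE hEul Φ hΦ t ht w hw hCw
  have hσZ' : σ < σZ := lt_of_lt_of_le hσlt (min_le_left _ _)
  have hσB' : σ < σB := lt_of_lt_of_le hσlt (min_le_right _ _)
  -- S_Z: the zero-free holomorphic continuations `Zc N` of the partition functions, strip `r₀`
  obtain ⟨r₀, hr₀, HZN⟩ := HZ σ hσ hσZ' a θp up ha hθ hu hbd
  choose Zc hZc using HZN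
  -- S_E: the holomorphic continuations `Nc N` of the unnormalised means, strip `r₁`
  obtain ⟨r₁, hr₁, HEN⟩ := HE B hB1 σ hσ a θp up ha hθ hu hbd Φ t w hw hCw
  choose Nc hNc using HEN
  -- the common strip and the quotient family
  have hS₀ : Metric.thickening (min r₀ r₁) (Complex.ofReal '' Set.Icc (0:ℝ) 1) ⊆
      Metric.thickening r₀ (Complex.ofReal '' Set.Icc (0:ℝ) 1) :=
    Metric.thickening_mono (min_le_left _ _) _
  have hS₁ : Metric.thickening (min r₀ r₁) (Complex.ofReal '' Set.Icc (0:ℝ) 1) ⊆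
      Metric.thickening r₁ (Complex.ofReal '' Set.Icc (0:ℝ) 1) :=
    Metric.thickening_mono (min_le_right _ _) _
  have hg : ∀ N : ℕ,
      DifferentiableOn ℂ ((fun N ζ => Nc N ζ / Zc N ζ) N)
        (Metric.thickening (min r₀ r₁) (Complex.ofReal '' Set.Icc (0:ℝ) 1)) ∧
      ∀ δ ∈ Set.Icc (0:ℝ) 1, (fun N ζ => Nc N ζ / Zc N ζ) N (δ : ℂ) =
        ((∫ z, (∫ y, w y ∂(empiricalMeasure ((Φ N).flow t z)))
          ∂(localGibbsLaw σ (a δ) (up δ) (θp δ) N (Φ N)) : ℝ) : ℂ) := by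
    intro N
    refine ⟨?_, ?_⟩
    · -- holomorphic quotient: numerator and denominator holomorphic, denominator zero-free
      exact ((hNc N).1.mono hS₁).div ((hZc N).1.mono hS₀) (fun ζ hζ => (hZc N).2.1 ζ (hS₀ hζ))
    · intro δ hδ
      -- on the real segment: `Zc N δ = Z_N δ ≠ 0` and `m_N δ * Z_N δ = Nc N δ`
      have hmem : (δ : ℂ) ∈ Metric.thickening r₀ (Complex.ofReal '' Set.Icc (0:ℝ) 1) :=
        Metric.self_subset_thickening hr₀ _ ⟨δ, hδ, rfl⟩
      have hZne : Zc N (δ : ℂ) ≠ 0 := (hZc N).2.1 _ hmem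
      have hZeq := (hZc N).2.2 δ hδ
      have hNeq := (hNc N).2 δ hδ
      rw [hZeq] at hZne
      show Nc N (δ : ℂ) / Zc N (δ : ℂ) = _
      rw [← hNeq, hZeq]
      exact mul_div_cancel_right₀ _ hZne
  -- S_B: the a-priori bound for this family of continuations
  obtain ⟨r', hr', hr'le, M, hM⟩ :=
    HB σ hσ hσB' a θp up ha hθ hu hbd T' ρE θE uE hEul Φ hΦ t ht w hw hCw (min r₀ r₁)
      (lt_min hr₀ hr₁) (fun N ζ => Nc N ζ / Zc N ζ) hg
  -- restrict to the thinner strip `r'`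
  exact ⟨r', hr', M, fun N =>
    ⟨(fun N ζ => Nc N ζ / Zc N ζ) N, (hg N).1.mono (Metric.thickening_mono hr'le _), hM N, (hg N).2⟩⟩

/-- D-0027 §3.3 shape: the crux from the registered stubs — an `example`, so that
`UniformAmplitudeAnalyticity_of` stays the unique theorem concluding the crux; it becomes the proof of
the item once the three `sorry`s are discharged. -/
example : Summit.AtomisticToContinuum.HydrodynamicLimit.Theses.VitaliAmplitudeTransfer.UniformAmplitudeAnalyticity :=
  UniformAmplitudeAnalyticity_of Holds.stub_canonicalZeroFreeStrip Holds.stub_numeratorExtension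
    Holds.stub_uniformBoundOnStrip

end

end Summit.AtomisticToContinuum.HydrodynamicLimit.Cruxes.UniformAmplitudeAnalyticity.Birth
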